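import Literature.Topology.FourManifolds.MMSWRasmussenFacts
import Literature.Topology.FourManifolds.MMSWRasmussenGeneralPosition
import Literature.AlgebraicTopology.SingularHomology.CompactManifoldFiniteness
import Literature.AlgebraicTopology.SingularHomology.LocalHomologyOfSetTransfer
import Literature.AlgebraicTopology.SingularHomology.EulerCharacteristicTriple
import Summits.SmoothPoincare4.SmoothPoincare4.Theorems.DottedCircleRasmussenDcrGapHelperFriendsCarrierExterior

/-!
# Helper `helper_modelHandlebody_localHomology_finite` of stub `stub_friendsH2` — part 1: finiteness from a deformation
(item stmt-SmoothPoincare4-16128, route route-SmoothPoincare4-DottedCircleRasmussen)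

The `H₂`-leaf of the friends lemma (line `mk_friends`, crux `DcrGap`) needs of the model dotted
handlebody `D_k ⊂ ℝ⁴` only that its local homology `H_q(ℝ⁴ | D_k; ℚ)`, `q = 2, 3`, is
finite-dimensional.  This file reduces that to a DEFORMATION statement about the bounded open set
`U = B(0, R + 3) ∖ D_k` (`R = 40(k+1)`), by R. L. Wilder's finiteness principle as it stands in the
tree (`hasFGInclRanges_of_normedSpace`, Bredon, *Sheaf Theory* II.17: for open `V` with compact
closure in the open set `U ⊆ ℝⁿ`, the image of `Hₙ(V) → Hₙ(U)` is finitely generated):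

* `FriendsH2.finite_singularHomology_of_deformation` — if an open `U ⊆ ℝ⁴` deforms into an open
  `V` with compact closure in `U` (a self-map of `U` with values in `V`, homotopic to the identity),
  then every `Hₙ(U; ℚ)` is finite-dimensional (`Hₙ(V) → Hₙ(U)` is onto by homotopy invariance);
* `FriendsH2.finite_localHomologyOfSet_of_finite_compl` — if `Hₙ(B(0, ρ) ∖ D_k; ℚ)` is
  finite-dimensional for `n = 1, 2` (`ρ > R + 1`), then so is `H_q(ℝ⁴ | D_k; ℚ)` for `q = 2, 3`
  (excision into the ball, Hatcher Thm. 2.20, and the long exact sequence of the pair, the ball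
  having finitely generated homology).

Everything is proved; no definitions, no named facts, no `sorry`.

## References

* G. E. Bredon, *Sheaf Theory*, 2nd ed., GTM 170, Springer 1997, §II.17. [Bredon1997]
* A. Hatcher, *Algebraic Topology*, CUP 2002, Thm. 2.10, Thm. 2.16, Thm. 2.20. [HatcherAT2002]
-/

-- the prescribed namespace `Summit.<P>.<Sub>.…` duplicates `SmoothPoincare4` (P = Sub)
set_option linter.dupNamespace false
set_option linter.style.longLine false

noncomputable section

open CategoryTheory Limits Set Function Metric Topology
open Literature.AlgebraicTopology.SingularHomology Literature.Topology.FourManifolds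
open Literature.Topology.FourManifolds.MMSW

namespace Summit.SmoothPoincare4.SmoothPoincare4.Theorems.DcrGap.MkFriends

namespace FriendsH2

/-! ## Finiteness from a deformation into a relatively compact open subset -/

/-- **Wilder's principle + homotopy invariance.**  Let `U ⊆ ℝ⁴` (indeed any real normed space) be
open and `V ⊆ U` open with compact closure contained in `U`.  If some continuous self-map `Φ` of
`U` with values in `V` is homotopic to the identity of `U`, then `Hₙ(U; ℚ)` is finite-dimensional
for every `n`: the image of `Hₙ(V) → Hₙ(U)` is finitely generated (Bredon 1997, II.17, the tree's
`hasFGInclRanges_of_normedSpace`) and it is everything, since `𝟙 = Φ_* = ι_* ∘ Φ'_*`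
(Hatcher Thm. 2.10). [cite: Bredon1997, §II.17 Thm. 17.4] [cite: HatcherAT2002, Thm. 2.10] -/
theorem finite_singularHomology_of_deformation {E : Type} [NormedAddCommGroup E] [NormedSpace ℝ E]
    {U V : Set E} (hU : IsOpen U) (hV : IsOpen V) (hVc : IsCompact (closure V)) (hVU : closure V ⊆ U)
    (Φ : C(U, U)) (hΦV : ∀ x, (Φ x : E) ∈ V) (hΦ : Φ.Homotopic (ContinuousMap.id U)) (n : ℕ) :
    Module.Finite ℚ (singularHomology ℚ ℚ U n) := by
  have hQ := hasFGInclRanges_of_normedSpace ℚ ℚ U hU hV hVc hVU n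
  set ι : C(V, U) := subsetInclusion (subset_closure.trans hVU) with hι
  -- `Φ = ι ∘ Φ'`
  let Φ' : C(U, V) := ⟨fun x => ⟨Φ x, hΦV x⟩, (map_continuous Φ).subtype_val.subtype_mk _⟩
  have hfac : ι.comp Φ' = Φ := by
    ext x
    rfl
  have hid : singularHomology.map ℚ ℚ Φ' n ≫ singularHomology.map ℚ ℚ ι n = 𝟙 _ := by
    rw [← singularHomology.map_comp, hfac, singularHomology.map_eq_of_homotopic ℚ ℚ hΦ,
      singularHomology.map_id]
  have hsurj : Surjective (singularHomology.map ℚ ℚ ι n) := by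
    intro y
    exact ⟨singularHomology.map ℚ ℚ Φ' n y, by rw [← ModuleCat.comp_apply, hid]; rfl⟩
  refine ⟨?_⟩
  rw [← LinearMap.range_eq_top.2 hsurj]
  exact hQ

/-! ## From the complement in a ball to the local homology of `ℝ⁴` along `D_k` -/

/-- **`H_q(ℝ⁴ | D_k; ℚ)` is finite-dimensional (`q = 2, 3`) as soon as `H₁`, `H₂` of
`B(0, ρ) ∖ D_k` are** (`ρ > 40(k+1) + 1`, so that `D_k ⊆ B(0, ρ)`): excision
`H_q(ℝ⁴ | D_k) ≅ H_q(B | D_k)` (Hatcher Thm. 2.20) and exactness of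
`H_q(B) → H_q(B | D_k) → H_{q-1}(B ∖ D_k)` (Thm. 2.16), the ball being convex.
[cite: HatcherAT2002, Thm. 2.16 and Thm. 2.20] -/
theorem finite_localHomologyOfSet_of_finite_compl (k : ℕ) {ρ : ℝ} (hρ : 40 * ((k : ℝ) + 1) + 1 < ρ)
    (hfin : ∀ n : ℕ, 1 ≤ n → n ≤ 2 → Module.Finite ℚ (singularHomology ℚ ℚ
      ↥({y : EuclideanSpace ℝ (Fin 4) | ‖y‖ < ρ ∧ y ∉ modelHandlebody k}) n))
    {q : ℕ} (hq2 : 2 ≤ q) (hq3 : q ≤ 3) :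
    Module.Finite ℚ (localHomologyOfSet ℚ ℚ (EuclideanSpace ℝ (Fin 4)) (modelHandlebody k) q) := by
  set Dk : Set (EuclideanSpace ℝ (Fin 4)) := modelHandlebody k with hDk
  set Ω : Set (EuclideanSpace ℝ (Fin 4)) := Metric.ball 0 ρ with hΩ
  have hDΩ : Dk ⊆ Ω := fun y hy =>
    mem_ball_zero_iff.2 ((DcrGfgmw.norm_le_of_mem_modelHandlebody hy).trans_lt hρ)
  -- excision into the ball
  haveI := localHomologyOfSet.isIso_map_subsetIncl_of_isClosed ℚ ℚ (isOpen_ball : IsOpen Ω)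
    (isClosed_modelHandlebody k) hDΩ q
  let T := (asIso (relativeSingularHomology.map ℚ ℚ (subsetIncl Ω)
    (localHomologyOfSet.mapsTo_val_compl Ω Dk) q)).toLinearEquiv
  suffices h : Module.Finite ℚ (localHomologyOfSet ℚ ℚ Ω (Subtype.val ⁻¹' Dk) q) from
    Module.Finite.equiv T
  -- the long exact sequence of `(Ω, Ω ∖ D_k)` at `H_q(Ω | D_k)`
  obtain ⟨q', rfl⟩ : ∃ q', q = q' + 1 := ⟨q - 1, by omega⟩
  haveI : Module.Finite ℚ (singularHomology ℚ ℚ Ω (q' + 1)) :=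
    finite_singularHomology_of_convex ℚ ℚ (convex_ball (0 : EuclideanSpace ℝ (Fin 4)) ρ) (q' + 1)
  -- `Ω ∖ D_k` as a subspace of `Ω` is the set of the hypothesis
  have hset : (Subtype.val : Ω → EuclideanSpace ℝ (Fin 4)) '' (Subtype.val ⁻¹' Dk)ᶜ =
      {y : EuclideanSpace ℝ (Fin 4) | ‖y‖ < ρ ∧ y ∉ modelHandlebody k} := by
    ext y
    constructor
    · rintro ⟨⟨y, hyΩ⟩, hy, rfl⟩
      exact ⟨mem_ball_zero_iff.1 hyΩ, hy⟩
    · rintro ⟨hy1, hy2⟩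
      exact ⟨⟨y, mem_ball_zero_iff.2 hy1⟩, hy2, rfl⟩
  let Θ : ↥((Subtype.val ⁻¹' Dk : Set Ω)ᶜ) ≃ₜ ↥({y : EuclideanSpace ℝ (Fin 4) | ‖y‖ < ρ ∧ y ∉ modelHandlebody k}) :=
    (IsEmbedding.subtypeVal.homeomorphImage _).trans (Homeomorph.setCongr hset)
  haveI := hfin q' (by omega) (by omega)
  haveI : Module.Finite ℚ (singularHomology ℚ ℚ ↥((Subtype.val ⁻¹' Dk : Set Ω)ᶜ) q') :=
    Module.Finite.equiv (singularHomology.xEquiv ℚ ℚ Θ q').symm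
  exact (relativeSingularHomology.exact_ofAbsolute_δ ℚ ℚ (X := Ω) (Subtype.val ⁻¹' Dk)ᶜ q').moduleCat_finite_X₂

end FriendsH2

/-- **Registered helper (HF part 1 of `stub_friendsH2`)**: finite-dimensionality of `H_q(ℝ⁴ | D_k; ℚ)` (`q = 2, 3`) from that of `H₁`, `H₂` of `B(0, ρ) ∖ D_k` (excision into the ball and the long exact sequence of the pair, Hatcher Thm. 2.16 / 2.20). [cite: HatcherAT2002, Thm. 2.16 and Thm. 2.20] -/
theorem helper_friendsH2_finiteOfCompl : ∀ (k : ℕ) (ρ : ℝ), 40 * ((k : ℝ) + 1) + 1 < ρ → (∀ n : ℕ, 1 ≤ n → n ≤ 2 → Module.Finite ℚ (Literature.AlgebraicTopology.SingularHomology.singularHomology ℚ ℚ ↥({y : EuclideanSpace ℝ (Fin 4) | ‖y‖ < ρ ∧ y ∉ Literature.Topology.FourManifolds.MMSW.modelHandlebody k}) n)) → ∀ q : ℕ, 2 ≤ q → q ≤ 3 → Module.Finite ℚ (Literature.AlgebraicTopology.SingularHomology.localHomologyOfSet ℚ ℚ (EuclideanSpace ℝ (Fin 4)) (Literature.Topology.FourManifolds.MMSW.modelHandlebody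 k) q) := fun k _ hρ hfin _ hq2 hq3 =>
  FriendsH2.finite_localHomologyOfSet_of_finite_compl k hρ hfin hq2 hq3

end Summit.SmoothPoincare4.SmoothPoincare4.Theorems.DcrGap.MkFriends

end
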